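import Mathlib.Analysis.SpecialFunctions.Elliptic.Weierstrass
import Mathlib.Algebra.MvPolynomial.Derivation
import Mathlib.Algebra.MvPolynomial.PDeriv
import Mathlib.RingTheory.Derivation.Lie
import Mathlib.Analysis.Calculus.IteratedDeriv.Lemmas
import Literature.NumberTheory.EllipticCurves.RealLatticePeriodHalfPeriodsProofs
import Literature.NumberTheory.Transcendental.MasserXiSet
import Literature.NumberTheory.Transcendental.ChudnovskyValues
import HarnessLib

/-!
# Masser 1975, Theorem I — the differential algebra of `℘(ω₁ z)`, `℘(ω₂ z)` (Lemma 1.2 / §1.3)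

Support for the proof of Theorem I (a transcendence measure for `τ = ω₂/ω₁`) of D. W. Masser,
*Elliptic Functions and Transcendence*, LNM 437 (1975), Ch. I, on the book's own line towards
Theorem II (`Literature.NumberTheory.Transcendental.masser_ellipticPeriods`).

In §1.3 the auxiliary function is `Φ(z) = ∑ p(λ₁,λ₂) ℘(ω₁z)^{λ₁} ℘(ω₂z)^{λ₂}` and its derivatives
at `z = 1/4` are computed by Lemma 1.2 (= Baker, *On the quasi-periods of the Weierstrass
ζ-function*, Lemma 2: `(d/dz)^m ℘(z)^ℓ` is an integer polynomial in `℘, ℘', ℘''`):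
`ω₁^{-m} Φ^{(m)}(1/4) = ∑ p(λ₁,λ₂) ∑_μ binom(m,μ) τ^μ ℘(ω₁/4; λ₁, m-μ) ℘(ω₂/4; λ₂, μ)` (p. 5,
proof of Lemma 1.8). We set this up as in the tree's proof of Schneider's theorem
(`SchneiderPeriodsProofs.lean`, Part II): the ring `R[X₀, X₁, X₂, X₃]`
(`X₀ ↔ ℘(ω₁z)`, `X₁ ↔ ℘'(ω₁z)`, `X₂ ↔ ℘(ω₂z)`, `X₃ ↔ ℘'(ω₂z)`) carries the two commuting
derivations `D₁ = X₁∂₀ + (6X₀² - b)∂₁`, `D₂ = X₃∂₂ + (6X₂² - b)∂₃` (`b ↔ g₂/2`,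
`℘'' = 6℘² - g₂/2`), and `d/dz` acts on `P(℘(ω₁z), ℘'(ω₁z), ℘(ω₂z), ℘'(ω₂z))` as
`ω₁ D₁ + ω₂ D₂` (`hasDerivAt_eval_v`, `iteratedDeriv_eval_v`); since `D₁ D₂ = D₂ D₁`
(`commute_D₁_D₂`), `(ω₁D₁ + ω₂D₂)^m = ∑ binom(m,μ) ω₁^{m-μ} ω₂^μ D₁^{m-μ} D₂^μ` and
`D₁^a D₂^b (X₀^{λ₁} X₂^{λ₂}) = D₁^a(X₀^{λ₁}) · D₂^b(X₂^{λ₂})` (`iter_mul_sep`), which is the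
displayed formula (`iteratedDeriv_biEval`).

Everything here is proved; no named facts. The arithmetic of the values (integrality, sizes) and
the rest of §1.3 are the sequel.

## References

* D. W. Masser, *Elliptic Functions and Transcendence*, Lecture Notes in Math. 437, Springer 1975,
  Ch. I §1.2 Lemma 1.2 and §1.3, proof of Lemma 1.8 (pp. 2, 5). [Masser1975]
* A. Baker, *Transcendental Number Theory*, CUP 1975, Ch. 6 §4 Lemma 2 (the pattern). [Baker1975]
-/

noncomputable section

open Complex Metric Set Filter MvPolynomial
open _root_.Topology
open scoped PeriodPair

namespace Literature.NumberTheory.Transcendental.Masser1975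

/-! ### The two derivations -/

section Derivations

variable {R : Type*} [CommRing R]

/-- Values of `D₁` on the variables: `X₀ ↦ X₁`, `X₁ ↦ 6X₀² - b`, `X₂, X₃ ↦ 0`.
[cite: Masser1975, Lemma 1.2] -/
def d₁Val (b : R) : Fin 4 → MvPolynomial (Fin 4) R := ![X 1, 6 * X 0 ^ 2 - C b, 0, 0]

/-- Values of `D₂` on the variables: `X₂ ↦ X₃`, `X₃ ↦ 6X₂² - b`, `X₀, X₁ ↦ 0`.
[cite: Masser1975, Lemma 1.2] -/
def d₂Val (b : R) : Fin 4 → MvPolynomial (Fin 4) R := ![0, 0, X 3, 6 * X 2 ^ 2 - C b]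

/-- `D₁ = X₁∂₀ + (6X₀² - b)∂₁`: the algebraic form of `ω₁⁻¹ d/dz` acting on the first pair
`(℘(ω₁z), ℘'(ω₁z))`. [cite: Masser1975, Lemma 1.2] -/
def D₁ (b : R) : Derivation R (MvPolynomial (Fin 4) R) (MvPolynomial (Fin 4) R) :=
  MvPolynomial.mkDerivation R (d₁Val b)

/-- `D₂ = X₃∂₂ + (6X₂² - b)∂₃`. [cite: Masser1975, Lemma 1.2] -/
def D₂ (b : R) : Derivation R (MvPolynomial (Fin 4) R) (MvPolynomial (Fin 4) R) :=
  MvPolynomial.mkDerivation R (d₂Val b)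

/-- `D₁ Xᵢ`. [folklore] -/
@[simp] theorem D₁_X (b : R) (i : Fin 4) : D₁ b (X i) = d₁Val b i :=
  MvPolynomial.mkDerivation_X _ _ _

/-- `D₂ Xᵢ`. [folklore] -/
@[simp] theorem D₂_X (b : R) (i : Fin 4) : D₂ b (X i) = d₂Val b i :=
  MvPolynomial.mkDerivation_X _ _ _

/-- `D₁ (C r) = 0`. [folklore] -/
@[simp] theorem D₁_C (b : R) (r : R) : D₁ b (C r) = 0 := MvPolynomial.derivation_C _ _

/-- `D₂ (C r) = 0`. [folklore] -/
@[simp] theorem D₂_C (b : R) (r : R) : D₂ b (C r) = 0 := MvPolynomial.derivation_C _ _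

/-- **The two derivations commute** (they act on disjoint pairs of variables).
[cite: Masser1975, §1.3 (proof of Lemma 1.8)] -/
theorem commutator_D₁_D₂ (b : R) : ⁅D₁ b, D₂ b⁆ = 0 := by
  have h6₁ : D₁ b (6 : MvPolynomial (Fin 4) R) = 0 := by
    rw [show (6 : MvPolynomial (Fin 4) R) = C 6 from (map_ofNat C 6).symm, D₁_C]
  have h6₂ : D₂ b (6 : MvPolynomial (Fin 4) R) = 0 := by
    rw [show (6 : MvPolynomial (Fin 4) R) = C 6 from (map_ofNat C 6).symm, D₂_C]
  refine MvPolynomial.derivation_ext fun i => ?_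
  rw [Derivation.commutator_apply]
  change _ = (0 : MvPolynomial (Fin 4) R)
  fin_cases i <;>
    simp [d₁Val, d₂Val, Derivation.leibniz, Derivation.leibniz_pow, h6₁, h6₂, map_sub]

/-- Pointwise commutation `D₁ (D₂ P) = D₂ (D₁ P)`. [folklore] -/
theorem D₁_D₂_comm (b : R) (P : MvPolynomial (Fin 4) R) : D₁ b (D₂ b P) = D₂ b (D₁ b P) := by
  have h := congrArg (fun D : Derivation R (MvPolynomial (Fin 4) R) (MvPolynomial (Fin 4) R) => D P)
    (commutator_D₁_D₂ b)
  simp only [Derivation.commutator_apply, Derivation.zero_apply, sub_eq_zero] at h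
  exact h

/-- The linear maps commute. [folklore] -/
theorem commute_D₁_D₂ (b : R) : Commute (D₁ b).toLinearMap (D₂ b).toLinearMap := by
  change (D₁ b).toLinearMap * (D₂ b).toLinearMap = (D₂ b).toLinearMap * (D₁ b).toLinearMap
  exact LinearMap.ext fun P => D₁_D₂_comm b P

/-- **Binomial expansion of the total derivation**: for scalars `c₁, c₂`,
`(c₁ D₁ + c₂ D₂)^m = ∑_μ binom(m, μ) (c₁ D₁)^μ (c₂ D₂)^{m-μ}`
(in the book `c₁ = ω₁`, `c₂ = ω₂ = τ ω₁`). [cite: Masser1975, §1.3 (proof of Lemma 1.8, "Q(λ₁,λ₂,m)")] -/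
theorem add_pow_D (b c₁ c₂ : R) (m : ℕ) :
    (c₁ • (D₁ b).toLinearMap + c₂ • (D₂ b).toLinearMap) ^ m =
      ∑ μ ∈ Finset.range (m + 1), (c₁ • (D₁ b).toLinearMap) ^ μ *
        (c₂ • (D₂ b).toLinearMap) ^ (m - μ) * (m.choose μ : Module.End R (MvPolynomial (Fin 4) R)) := by
  have hc : Commute (c₁ • (D₁ b).toLinearMap) (c₂ • (D₂ b).toLinearMap) :=
    ((commute_D₁_D₂ b).smul_left c₁).smul_right c₂
  exact hc.add_pow m

/-- `D₁` kills polynomials in `X₂, X₃`: `D₁ (X₂^k) = 0`. [folklore] -/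
theorem D₁_X2_pow (b : R) (k : ℕ) : D₁ b (X 2 ^ k) = 0 := by
  rw [Derivation.leibniz_pow, D₁_X]
  simp [d₁Val]

/-- `D₂ (X₀^i) = 0`. [folklore] -/
theorem D₂_X0_pow (b : R) (i : ℕ) : D₂ b (X 0 ^ i) = 0 := by
  rw [Derivation.leibniz_pow, D₂_X]
  simp [d₂Val]

/-- Iterates of a derivation past a constant factor: if `D Q = 0` then `D^a (P Q) = D^a(P) Q`.
[folklore] -/
theorem iter_mul_const {A : Type*} [CommRing A] [Algebra R A] (D : Derivation R A A) {Q : A}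
    (hQ : D Q = 0) (a : ℕ) (P : A) : (D.toLinearMap ^ a) (P * Q) = (D.toLinearMap ^ a) P * Q := by
  induction a generalizing P with
  | zero => simp
  | succ a ih =>
    rw [pow_succ, Module.End.mul_apply, Module.End.mul_apply]
    change (D.toLinearMap ^ a) (D (P * Q)) = (D.toLinearMap ^ a) (D P) * Q
    rw [Derivation.leibniz, hQ, smul_zero, zero_add, smul_eq_mul, mul_comm Q, ih]

/-- `D₂` kills every iterate `D₁^a (X₀^i)`. [folklore] -/
theorem D₂_iter_D₁_X0_pow (b : R) (a i : ℕ) : D₂ b (((D₁ b).toLinearMap ^ a) (X 0 ^ i)) = 0 := by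
  induction a with
  | zero => simpa using D₂_X0_pow b i
  | succ a ih =>
    rw [pow_succ', Module.End.mul_apply]
    change D₂ b (D₁ b (((D₁ b).toLinearMap ^ a) (X 0 ^ i))) = 0
    rw [← D₁_D₂_comm, ih, map_zero]

/-- `D₁` kills every iterate `D₂^c (X₂^k)`. [folklore] -/
theorem D₁_iter_D₂_X2_pow (b : R) (c k : ℕ) : D₁ b (((D₂ b).toLinearMap ^ c) (X 2 ^ k)) = 0 := by
  induction c with
  | zero => simpa using D₁_X2_pow b k
  | succ c ih =>
    rw [pow_succ', Module.End.mul_apply]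
    change D₁ b (D₂ b (((D₂ b).toLinearMap ^ c) (X 2 ^ k))) = 0
    rw [D₁_D₂_comm, ih, map_zero]

/-- **Separation of variables**: `D₁^a D₂^c (X₀^i X₂^k) = D₁^a(X₀^i) · D₂^c(X₂^k)`.
[cite: Masser1975, §1.3 (proof of Lemma 1.8)] -/
theorem iter_mul_sep (b : R) (a c i k : ℕ) :
    ((D₁ b).toLinearMap ^ a) (((D₂ b).toLinearMap ^ c) (X 0 ^ i * X 2 ^ k)) =
      ((D₁ b).toLinearMap ^ a) (X 0 ^ i) * ((D₂ b).toLinearMap ^ c) (X 2 ^ k) := by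
  have h2 : ((D₂ b).toLinearMap ^ c) (X 0 ^ i * X 2 ^ k) = X 0 ^ i * ((D₂ b).toLinearMap ^ c) (X 2 ^ k) := by
    rw [mul_comm, iter_mul_const (D₂ b) (D₂_X0_pow b i) c, mul_comm]
  rw [h2, iter_mul_const (D₁ b) (D₁_iter_D₂_X2_pow b c k) a]

end Derivations

/-! ### The chain rule for polynomials in `℘(ω₁z), ℘'(ω₁z), ℘(ω₂z), ℘'(ω₂z)` -/

variable (L : PeriodPair)

/-- The vector `(℘(ω₁z), ℘'(ω₁z), ℘(ω₂z), ℘'(ω₂z))`. [folklore] -/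
def v (z : ℂ) : Fin 4 → ℂ :=
  ![℘[L] (L.ω₁ * z), ℘'[L] (L.ω₁ * z), ℘[L] (L.ω₂ * z), ℘'[L] (L.ω₂ * z)]

/-- `v 0 = ℘(ω₁ z) = scaledP 0`. [folklore] -/
@[simp] theorem v_zero (z : ℂ) : v L z 0 = scaledP L 0 z := by simp [v, scaledP]
/-- `v 1 = ℘'(ω₁ z)`. [folklore] -/
@[simp] theorem v_one (z : ℂ) : v L z 1 = ℘'[L] (L.ω₁ * z) := rfl
/-- `v 2 = ℘(ω₂ z) = scaledP 1`. [folklore] -/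
@[simp] theorem v_two (z : ℂ) : v L z 2 = scaledP L 1 z := by simp [v, scaledP]
/-- `v 3 = ℘'(ω₂ z)`. [folklore] -/
@[simp] theorem v_three (z : ℂ) : v L z 3 = ℘'[L] (L.ω₂ * z) := rfl

/-- The total derivation `D = ω₁ D₁ + ω₂ D₂` over `ℂ` with `b = g₂/2`. [cite: Masser1975, §1.3] -/
def Dtot : Module.End ℂ (MvPolynomial (Fin 4) ℂ) :=
  L.ω₁ • (D₁ (L.g₂ / 2)).toLinearMap + L.ω₂ • (D₂ (L.g₂ / 2)).toLinearMap

/-- The regular set: `ω₁ z ∉ Λ` and `ω₂ z ∉ Λ`. [folklore] -/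
def regSet : Set ℂ := {z | L.ω₁ * z ∉ L.lattice ∧ L.ω₂ * z ∉ L.lattice}

/-- The regular set is open. [folklore] -/
theorem isOpen_regSet : IsOpen (regSet L) := by
  have h1 : IsOpen {z : ℂ | L.ω₁ * z ∉ L.lattice} :=
    L.isClosed_lattice.isOpen_compl.preimage (continuous_const.mul continuous_id)
  have h2 : IsOpen {z : ℂ | L.ω₂ * z ∉ L.lattice} :=
    L.isClosed_lattice.isOpen_compl.preimage (continuous_const.mul continuous_id)
  exact h1.inter h2

variable {L}

/-- `℘(ω ·)` has derivative `ω ℘'(ω z)`. [folklore] -/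
theorem hasDerivAt_weierstrassP_mul (ω : ℂ) {z : ℂ} (hz : ω * z ∉ L.lattice) :
    HasDerivAt (fun w => ℘[L] (ω * w)) (ω * ℘'[L] (ω * z)) z := by
  have hd : DifferentiableAt ℂ ℘[L] (ω * z) :=
    (L.differentiableOn_weierstrassP _ hz).differentiableAt
      (L.isClosed_lattice.isOpen_compl.mem_nhds hz)
  have h1 : HasDerivAt ℘[L] (℘'[L] (ω * z)) (ω * z) := by
    rw [← L.deriv_weierstrassP]
    exact hd.hasDerivAt
  have h2 : HasDerivAt (fun w : ℂ => ω * w) ω z := by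
    simpa using (hasDerivAt_id z).const_mul ω
  have h := h1.comp z h2
  rwa [mul_comm] at h

/-- `℘'(ω ·)` has derivative `ω (6℘(ωz)² - g₂/2)`. [folklore] -/
theorem hasDerivAt_derivWeierstrassP_mul (ω : ℂ) {z : ℂ} (hz : ω * z ∉ L.lattice) :
    HasDerivAt (fun w => ℘'[L] (ω * w)) (ω * (6 * ℘[L] (ω * z) ^ 2 - L.g₂ / 2)) z := by
  have h1 : HasDerivAt ℘'[L] (6 * ℘[L] (ω * z) ^ 2 - L.g₂ / 2) (ω * z) :=
    L.hasDerivAt_derivWeierstrassP hz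
  have h2 : HasDerivAt (fun w : ℂ => ω * w) ω z := by
    simpa using (hasDerivAt_id z).const_mul ω
  have h := h1.comp z h2
  rwa [mul_comm] at h

/-- The coordinates satisfy `d/dz vᵢ = (D Xᵢ)(v)` on the regular set. [cite: Masser1975, Lemma 1.2] -/
theorem hasDerivAt_v {z : ℂ} (hz : z ∈ regSet L) (i : Fin 4) :
    HasDerivAt (fun w => v L w i) (eval (v L z) (Dtot L (X i))) z := by
  obtain ⟨hz1, hz2⟩ := hz
  fin_cases i
  · simpa [Dtot, v, d₁Val, d₂Val] using hasDerivAt_weierstrassP_mul L.ω₁ hz1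
  · simpa [Dtot, v, d₁Val, d₂Val] using hasDerivAt_derivWeierstrassP_mul L.ω₁ hz1
  · simpa [Dtot, v, d₁Val, d₂Val] using hasDerivAt_weierstrassP_mul L.ω₂ hz2
  · simpa [Dtot, v, d₁Val, d₂Val] using hasDerivAt_derivWeierstrassP_mul L.ω₂ hz2

/-- `Dtot` is a derivation (sum of scalar multiples of derivations): Leibniz rule. [folklore] -/
theorem Dtot_mul (P Q : MvPolynomial (Fin 4) ℂ) : Dtot L (P * Q) = P * Dtot L Q + Q * Dtot L P := by
  simp only [Dtot, LinearMap.add_apply, LinearMap.smul_apply, Derivation.coeFn_coe,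
    Derivation.leibniz, smul_eq_mul, smul_add, MvPolynomial.smul_eq_C_mul]
  ring

/-- `Dtot (C r) = 0`. [folklore] -/
@[simp] theorem Dtot_C (r : ℂ) : Dtot L (C r) = 0 := by
  simp [Dtot]

/-- **Chain rule**: `d/dz P(v(z)) = (Dtot P)(v(z))` on the regular set. [cite: Masser1975, Lemma 1.2] -/
theorem hasDerivAt_eval_v (P : MvPolynomial (Fin 4) ℂ) {z : ℂ} (hz : z ∈ regSet L) :
    HasDerivAt (fun w => eval (v L w) P) (eval (v L z) (Dtot L P)) z := by
  induction P using MvPolynomial.induction_on with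
  | C r => simpa using hasDerivAt_const z r
  | add p q hp hq =>
    simp only [map_add]
    exact hp.add hq
  | mul_X p i hp =>
    have hi := hasDerivAt_v hz i
    have := hp.mul hi
    simp only [map_mul, eval_X]
    refine this.congr_deriv ?_
    rw [Dtot_mul]
    simp only [map_add, map_mul, eval_X]
    ring

/-- Iterated chain rule: `(d/dz)^k P(v(z)) = (Dtot^k P)(v(z))` on the regular set.
[cite: Masser1975, Lemma 1.2] -/
theorem iteratedDeriv_eval_v (k : ℕ) (P : MvPolynomial (Fin 4) ℂ) {z : ℂ} (hz : z ∈ regSet L) :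
    iteratedDeriv k (fun w => eval (v L w) P) z = eval (v L z) ((Dtot L ^ k) P) := by
  induction k generalizing z with
  | zero => simp
  | succ k ih =>
    rw [iteratedDeriv_succ, pow_succ', Module.End.mul_apply]
    have hev : iteratedDeriv k (fun w => eval (v L w) P) =ᶠ[𝓝 z]
        fun w => eval (v L w) ((Dtot L ^ k) P) := by
      filter_upwards [(isOpen_regSet L).mem_nhds hz] with w hw
      exact ih hw
    rw [hev.deriv_eq]
    exact (hasDerivAt_eval_v _ hz).deriv

/-! ### The auxiliary function as a polynomial and its derivatives -/

/-- The polynomial `∑_{λ₁,λ₂ ≤ n} p(λ₁,λ₂) X₀^{λ₁} X₂^{λ₂}`. [folklore] -/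
def toPoly (n : ℕ) (p : ℕ → ℕ → ℂ) : MvPolynomial (Fin 4) ℂ :=
  ∑ i ∈ Finset.range (n + 1), ∑ j ∈ Finset.range (n + 1), C (p i j) * (X 0 ^ i * X 2 ^ j)

/-- `Φ(z) = biEval = (toPoly p)(v(z))`. [folklore] -/
theorem biEval_eq_eval_toPoly (n : ℕ) (p : ℕ → ℕ → ℂ) (z : ℂ) :
    biEval L n p z = eval (v L z) (toPoly n p) := by
  unfold biEval toPoly
  simp only [map_sum, map_mul, eval_C, map_pow, eval_X, v_zero, v_two, Finset.sum_mul]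
  refine Finset.sum_congr rfl fun i _ => Finset.sum_congr rfl fun j _ => ?_
  ring

/-- **The derivatives of `Φ`** at a regular point:
`Φ^{(m)}(z) = ∑ p(λ₁,λ₂) ∑_μ binom(m,μ) ω₁^{μ} ω₂^{m-μ} (D₁^{μ} X₀^{λ₁})(v z) (D₂^{m-μ} X₂^{λ₂})(v z)`
— Masser's `ω₁^m ∑ p Q(λ₁,λ₂,m)` with `τ = ω₂/ω₁` (p. 5), written without dividing by `ω₁`.
[cite: Masser1975, §1.3 (proof of Lemma 1.8, eq. (10))] -/
theorem iteratedDeriv_biEval (n : ℕ) (p : ℕ → ℕ → ℂ) (m : ℕ) {z : ℂ} (hz : z ∈ regSet L) :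
    iteratedDeriv m (biEval L n p) z =
      ∑ i ∈ Finset.range (n + 1), ∑ j ∈ Finset.range (n + 1), p i j *
        ∑ μ ∈ Finset.range (m + 1), (m.choose μ : ℂ) * (L.ω₁ ^ μ * L.ω₂ ^ (m - μ)) *
          (eval (v L z) (((D₁ (L.g₂ / 2)).toLinearMap ^ μ) (X 0 ^ i)) *
            eval (v L z) (((D₂ (L.g₂ / 2)).toLinearMap ^ (m - μ)) (X 2 ^ j))) := by
  have hF : biEval L n p = fun w => eval (v L w) (toPoly n p) := funext (biEval_eq_eval_toPoly n p)
  rw [hF, iteratedDeriv_eval_v m _ hz]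
  unfold toPoly
  simp only [map_sum]
  refine Finset.sum_congr rfl fun i _ => Finset.sum_congr rfl fun j _ => ?_
  have hC : ((Dtot L ^ m) (C (p i j) * (X 0 ^ i * X 2 ^ j))) =
      C (p i j) * (Dtot L ^ m) (X 0 ^ i * X 2 ^ j) := by
    rw [← smul_eq_C_mul, ← smul_eq_C_mul, map_smul]
  rw [hC, map_mul, eval_C]
  congr 1
  rw [Dtot, add_pow_D, LinearMap.sum_apply, map_sum]
  refine Finset.sum_congr rfl fun μ _ => ?_
  rw [Module.End.mul_apply, Module.End.mul_apply, Module.End.natCast_apply, smul_pow, smul_pow,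
    LinearMap.smul_apply, LinearMap.smul_apply, map_nsmul, LinearMap.map_smul, map_nsmul,
    iter_mul_sep, MvPolynomial.smul_eq_C_mul, MvPolynomial.smul_eq_C_mul, nsmul_eq_mul, map_mul,
    map_mul, map_mul, map_mul, eval_C, eval_C, map_natCast]
  ring

/-! ### The formal side: integer polynomials in `(X₀,…,X₃; a₀,…,a₄)`

As in `SchneiderPeriodsProofs.lean` (Part II): `a₀ ↔ g₂/2`, `a₁ ↔ ℘(ω₁/4)`, `a₂ ↔ ℘'(ω₁/4)`,
`a₃ ↔ ℘(ω₂/4)`, `a₄ ↔ ℘'(ω₂/4)`; the formal values `U₁(λ₁, a) = (D₁^a X₀^{λ₁})(a₁, a₂)`,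
`U₂(λ₂, c) = (D₂^c X₂^{λ₂})(a₃, a₄)` are Masser's `℘(¼ωᵢ, λᵢ, ·)` as INTEGER polynomials in the
`a_t` (Lemma 1.2: "`U(t,t',t'',m,ℓ)` denotes a rational integer with absolute value at most
`m! c₃^{ℓ+m}`"), with the degree and height bounds used in (9), p. 5.
-/

section Formal

open Literature.NumberTheory.Transcendental.Chudnovsky (l1 wnorm wnorm_sub_le wnorm_X wnorm_C
  wnorm_mul_le wnorm_X_pow_le wnorm_nonneg wnorm_zero normRingSeminorm_int_one
  normRingSeminorm_int_apply totalDegree_mkDerivation_pow_le l1_mkDerivation_pow_le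
  totalDegree_aeval_le_of_le_one l1_aeval_le)

/-- The coefficient ring `R₅ = ℤ[a₀, …, a₄]`. [folklore] -/
abbrev R₅ : Type := MvPolynomial (Fin 5) ℤ

/-- The flat formal ring `R₉ = ℤ[X₀, …, X₃; a₀, …, a₄]`. [folklore] -/
abbrev R₉ : Type := MvPolynomial (Fin 4 ⊕ Fin 5) ℤ

/-- Values of the formal `D₁`: `X₀ ↦ X₁`, `X₁ ↦ 6X₀² - a₀`, everything else `↦ 0`.
[cite: Masser1975, Lemma 1.2] -/
def d₁val : Fin 4 ⊕ Fin 5 → R₉ :=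
  Sum.elim ![X (Sum.inl 1), 6 * X (Sum.inl 0) ^ 2 - X (Sum.inr 0), 0, 0] 0

/-- Values of the formal `D₂`: `X₂ ↦ X₃`, `X₃ ↦ 6X₂² - a₀`, everything else `↦ 0`.
[cite: Masser1975, Lemma 1.2] -/
def d₂val : Fin 4 ⊕ Fin 5 → R₉ :=
  Sum.elim ![0, 0, X (Sum.inl 3), 6 * X (Sum.inl 2) ^ 2 - X (Sum.inr 0)] 0

/-- The formal derivation `D₁₀` of `ℤ[X; a]`. [cite: Masser1975, Lemma 1.2] -/
def D₁₀ : Derivation ℤ R₉ R₉ := MvPolynomial.mkDerivation ℤ d₁val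

/-- The formal derivation `D₂₀` of `ℤ[X; a]`. [cite: Masser1975, Lemma 1.2] -/
def D₂₀ : Derivation ℤ R₉ R₉ := MvPolynomial.mkDerivation ℤ d₂val

/-- `D₁₀ X_s = d₁val s`. [folklore] -/
@[simp] theorem D₁₀_X (s : Fin 4 ⊕ Fin 5) : D₁₀ (X s) = d₁val s :=
  MvPolynomial.mkDerivation_X _ _ _

/-- `D₂₀ X_s = d₂val s`. [folklore] -/
@[simp] theorem D₂₀_X (s : Fin 4 ⊕ Fin 5) : D₂₀ (X s) = d₂val s :=
  MvPolynomial.mkDerivation_X _ _ _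

/-- The substitution at `z = 1/4`: `X₀ ↦ a₁`, `X₁ ↦ a₂`, `X₂ ↦ a₃`, `X₃ ↦ a₄`, `a_t ↦ a_t`.
[folklore] -/
def sval : Fin 4 ⊕ Fin 5 → R₅ := Sum.elim ![X 1, X 2, X 3, X 4] X

/-- `U₁(λ₁, a) = (D₁^a X₀^{λ₁})(a₁, a₂; a) ∈ ℤ[a]`: the formal value of
`ω₁^{-a} (d/dz)^a ℘(ω₁z)^{λ₁}` at `z = 1/4` (Masser's `℘(¼ω₁, λ₁, a)`). [cite: Masser1975, Lemma 1.2] -/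
def U₁ (i a : ℕ) : R₅ := MvPolynomial.aeval sval ((D₁₀.toLinearMap ^ a) (X (Sum.inl 0) ^ i))

/-- `U₂(λ₂, c) = (D₂^c X₂^{λ₂})(a₃, a₄; a) ∈ ℤ[a]` (Masser's `℘(¼ω₂, λ₂, c)`). [cite: Masser1975, Lemma 1.2] -/
def U₂ (k c : ℕ) : R₅ := MvPolynomial.aeval sval ((D₂₀.toLinearMap ^ c) (X (Sum.inl 2) ^ k))

variable (L)

/-- The numbers `a = (g₂/2, ℘(ω₁/4), ℘'(ω₁/4), ℘(ω₂/4), ℘'(ω₂/4))`. [cite: Masser1975, §1.3 (proof of Lemma 1.8, the field 𝔽)] -/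
def xv : Fin 5 → ℂ :=
  ![L.g₂ / 2, ℘[L] (L.ω₁ / 4), ℘'[L] (L.ω₁ / 4), ℘[L] (L.ω₂ / 4), ℘'[L] (L.ω₂ / 4)]

/-- The specialisation `ℤ[a] → ℂ`. [folklore] -/
abbrev φx : R₅ →+* ℂ := (MvPolynomial.aeval (xv L) : R₅ →ₐ[ℤ] ℂ).toRingHom

/-- The specialisation of the constants `ℤ[X; a] → ℂ[X]`, `Xᵢ ↦ Xᵢ`. [folklore] -/
abbrev ψx : R₉ →ₐ[ℤ] MvPolynomial (Fin 4) ℂ :=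
  MvPolynomial.aeval (Sum.elim X fun t => C (xv L t))

/-- `ψx` intertwines `d₁val` and `D₁`. [folklore] -/
theorem ψx_d₁val (s : Fin 4 ⊕ Fin 5) : ψx L (d₁val s) = D₁ (L.g₂ / 2) (ψx L (X s)) := by
  rcases s with s | t
  · fin_cases s <;> simp [d₁val, d₁Val, xv, map_sub]
  · simp [d₁val]

/-- `ψx` intertwines `d₂val` and `D₂`. [folklore] -/
theorem ψx_d₂val (s : Fin 4 ⊕ Fin 5) : ψx L (d₂val s) = D₂ (L.g₂ / 2) (ψx L (X s)) := by
  rcases s with s | t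
  · fin_cases s <;> simp [d₂val, d₂Val, xv, map_sub]
  · simp [d₂val]

/-- **Specialisation commutes with `D₁`.** [folklore] -/
theorem ψx_D₁₀ (Q : R₉) : ψx L (D₁₀ Q) = D₁ (L.g₂ / 2) (ψx L Q) := by
  induction Q using MvPolynomial.induction_on with
  | C r =>
    rw [D₁₀, MvPolynomial.derivation_C, map_zero, MvPolynomial.aeval_C, eq_intCast,
      Derivation.map_intCast]
  | add p q hp hq => simp only [map_add, hp, hq]
  | mul_X p s hp =>
    rw [Derivation.leibniz, smul_eq_mul, smul_eq_mul, map_add, map_mul, map_mul, hp, D₁₀_X,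
      ψx_d₁val, map_mul, (D₁ (L.g₂ / 2)).leibniz, smul_eq_mul, smul_eq_mul]

/-- **Specialisation commutes with `D₂`.** [folklore] -/
theorem ψx_D₂₀ (Q : R₉) : ψx L (D₂₀ Q) = D₂ (L.g₂ / 2) (ψx L Q) := by
  induction Q using MvPolynomial.induction_on with
  | C r =>
    rw [D₂₀, MvPolynomial.derivation_C, map_zero, MvPolynomial.aeval_C, eq_intCast,
      Derivation.map_intCast]
  | add p q hp hq => simp only [map_add, hp, hq]
  | mul_X p s hp =>
    rw [Derivation.leibniz, smul_eq_mul, smul_eq_mul, map_add, map_mul, map_mul, hp, D₂₀_X,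
      ψx_d₂val, map_mul, (D₂ (L.g₂ / 2)).leibniz, smul_eq_mul, smul_eq_mul]

/-- The same for the iterates of `D₁`. [folklore] -/
theorem ψx_D₁₀_pow (a : ℕ) (Q : R₉) :
    ψx L ((D₁₀.toLinearMap ^ a) Q) = ((D₁ (L.g₂ / 2)).toLinearMap ^ a) (ψx L Q) := by
  induction a generalizing Q with
  | zero => simp
  | succ a ih =>
    rw [pow_succ, pow_succ, Module.End.mul_apply, Module.End.mul_apply, ih]
    exact congrArg _ (ψx_D₁₀ L Q)

/-- The same for the iterates of `D₂`. [folklore] -/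
theorem ψx_D₂₀_pow (c : ℕ) (Q : R₉) :
    ψx L ((D₂₀.toLinearMap ^ c) Q) = ((D₂ (L.g₂ / 2)).toLinearMap ^ c) (ψx L Q) := by
  induction c generalizing Q with
  | zero => simp
  | succ c ih =>
    rw [pow_succ, pow_succ, Module.End.mul_apply, Module.End.mul_apply, ih]
    exact congrArg _ (ψx_D₂₀ L Q)

/-- The point `1/4` is regular: `ωᵢ/4 ∉ Λ`. [cite: Masser1975, Lemma 1.1] -/
theorem quarter_mem_regSet : (1 / 4 : ℂ) ∈ regSet L := by
  constructor
  · rw [mul_one_div]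
    simpa [inv_mul_eq_div] using
      (L.mul_ω₁_add_mul_ω₂_mem_lattice (α := 1 / 4) (β := 0)).not.mpr (by norm_num)
  · rw [mul_one_div]
    simpa [inv_mul_eq_div] using
      (L.mul_ω₁_add_mul_ω₂_mem_lattice (α := 0) (β := 1 / 4)).not.mpr (by norm_num)

/-- `v(1/4) = (a₁, a₂, a₃, a₄)`. [folklore] -/
theorem v_quarter : v L (1 / 4) = ![xv L 1, xv L 2, xv L 3, xv L 4] := by
  ext i
  fin_cases i <;> simp [v, xv, div_eq_mul_inv]

/-- Compatibility of the two evaluations at `z = 1/4`. [folklore] -/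
theorem φx_aeval_sval (Q : R₉) :
    φx L (MvPolynomial.aeval sval Q) = eval (v L (1 / 4)) (ψx L Q) := by
  change ((φx L).comp (MvPolynomial.aeval sval : R₉ →ₐ[ℤ] R₅).toRingHom) Q =
    ((MvPolynomial.eval (v L (1 / 4))).comp (ψx L).toRingHom) Q
  congr 1
  refine MvPolynomial.ringHom_ext (fun r => by simp) (fun s => ?_)
  rw [v_quarter]
  rcases s with s | t
  · fin_cases s <;> simp [sval, xv]
  · fin_cases t <;> simp [sval, xv]

/-- `φx (U₁ i a) = (D₁^a X₀^i)(v(1/4))`. [folklore] -/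
theorem φx_U₁ (i a : ℕ) :
    φx L (U₁ i a) = eval (v L (1 / 4)) (((D₁ (L.g₂ / 2)).toLinearMap ^ a) (X 0 ^ i)) := by
  unfold U₁
  rw [φx_aeval_sval, ψx_D₁₀_pow]
  congr 2
  simp [map_pow]

/-- `φx (U₂ k c) = (D₂^c X₂^k)(v(1/4))`. [folklore] -/
theorem φx_U₂ (k c : ℕ) :
    φx L (U₂ k c) = eval (v L (1 / 4)) (((D₂ (L.g₂ / 2)).toLinearMap ^ c) (X 2 ^ k)) := by
  unfold U₂
  rw [φx_aeval_sval, ψx_D₂₀_pow]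
  congr 2
  simp [map_pow]

/-- **Value formula at `z = 1/4`** (proof of Lemma 1.8, p. 5: "`ω₁^{-m} Φ_m(¼)` is the expression
`A_m` with `α` replaced by `τ`"):
`Φ^{(m)}(1/4) = ∑ p(λ₁,λ₂) ∑_μ binom(m,μ) ω₁^μ ω₂^{m-μ} U₁(λ₁, μ)(a) U₂(λ₂, m-μ)(a)`.
[cite: Masser1975, §1.3 (proof of Lemma 1.8, eq. (10))] -/
theorem iteratedDeriv_biEval_quarter (n : ℕ) (p : ℕ → ℕ → ℂ) (m : ℕ) :
    iteratedDeriv m (biEval L n p) (1 / 4) =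
      ∑ i ∈ Finset.range (n + 1), ∑ j ∈ Finset.range (n + 1), p i j *
        ∑ μ ∈ Finset.range (m + 1), (m.choose μ : ℂ) * (L.ω₁ ^ μ * L.ω₂ ^ (m - μ)) *
          (φx L (U₁ i μ) * φx L (U₂ j (m - μ))) := by
  rw [iteratedDeriv_biEval n p m (quarter_mem_regSet L)]
  simp_rw [φx_U₁, φx_U₂]

variable {L}

/-! ### Degrees and heights of the formal values -/

/-- `deg (d₁val s) ≤ 2`. [folklore] -/
theorem totalDegree_d₁val_le (s : Fin 4 ⊕ Fin 5) : (d₁val s).totalDegree ≤ 2 := by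
  rcases s with s | t
  · fin_cases s
    · change (X (Sum.inl 1) : R₉).totalDegree ≤ 2
      rw [totalDegree_X]; norm_num
    · change (6 * X (Sum.inl 0) ^ 2 - X (Sum.inr 0) : R₉).totalDegree ≤ 2
      refine (totalDegree_sub _ _).trans (max_le ?_ ?_)
      · refine (totalDegree_mul _ _).trans ?_
        rw [show (6 : R₉) = C 6 from (map_ofNat C 6).symm, totalDegree_C, totalDegree_X_pow]
      · rw [totalDegree_X]; norm_num
    · change (0 : R₉).totalDegree ≤ 2
      rw [totalDegree_zero]; norm_num
    · change (0 : R₉).totalDegree ≤ 2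
      rw [totalDegree_zero]; norm_num
  · change (0 : R₉).totalDegree ≤ 2
    rw [totalDegree_zero]; norm_num

/-- `deg (d₂val s) ≤ 2`. [folklore] -/
theorem totalDegree_d₂val_le (s : Fin 4 ⊕ Fin 5) : (d₂val s).totalDegree ≤ 2 := by
  rcases s with s | t
  · fin_cases s
    · change (0 : R₉).totalDegree ≤ 2
      rw [totalDegree_zero]; norm_num
    · change (0 : R₉).totalDegree ≤ 2
      rw [totalDegree_zero]; norm_num
    · change (X (Sum.inl 3) : R₉).totalDegree ≤ 2
      rw [totalDegree_X]; norm_num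
    · change (6 * X (Sum.inl 2) ^ 2 - X (Sum.inr 0) : R₉).totalDegree ≤ 2
      refine (totalDegree_sub _ _).trans (max_le ?_ ?_)
      · refine (totalDegree_mul _ _).trans ?_
        rw [show (6 : R₉) = C 6 from (map_ofNat C 6).symm, totalDegree_C, totalDegree_X_pow]
      · rw [totalDegree_X]; norm_num
  · change (0 : R₉).totalDegree ≤ 2
    rw [totalDegree_zero]; norm_num

/-- `l1` of the quadratic value `6X² - a₀` is `≤ 7`. [folklore] -/
theorem l1_quad_le (u : Fin 4) : l1 (6 * X (Sum.inl u) ^ 2 - X (Sum.inr 0) : R₉) ≤ 7 := by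
  refine (wnorm_sub_le _ _ _).trans ?_
  have h6 : l1 (6 * X (Sum.inl u) ^ 2 : R₉) ≤ 6 := by
    refine (wnorm_mul_le _ _ _).trans ?_
    rw [show (6 : R₉) = C 6 from (map_ofNat C 6).symm, wnorm_C, normRingSeminorm_int_apply]
    have := wnorm_X_pow_le (normRingSeminorm ℤ) (by simp) (Sum.inl u : Fin 4 ⊕ Fin 5) 2
    have h0 := wnorm_nonneg (normRingSeminorm ℤ) ((X (Sum.inl u) : R₉) ^ 2)
    norm_num
    nlinarith
  have hX : l1 (X (Sum.inr 0) : R₉) = 1 := by rw [l1, wnorm_X, normRingSeminorm_int_one]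
  unfold l1 at h6 hX
  linarith

/-- `l1 (d₁val s) ≤ 7`. [folklore] -/
theorem l1_d₁val_le (s : Fin 4 ⊕ Fin 5) : l1 (d₁val s) ≤ 7 := by
  rcases s with s | t
  · fin_cases s
    · change l1 (X (Sum.inl 1) : R₉) ≤ 7
      rw [l1, wnorm_X, normRingSeminorm_int_one]; norm_num
    · exact l1_quad_le 0
    · change l1 (0 : R₉) ≤ 7
      rw [l1, wnorm_zero]; norm_num
    · change l1 (0 : R₉) ≤ 7
      rw [l1, wnorm_zero]; norm_num
  · change l1 (0 : R₉) ≤ 7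
    rw [l1, wnorm_zero]; norm_num

/-- `l1 (d₂val s) ≤ 7`. [folklore] -/
theorem l1_d₂val_le (s : Fin 4 ⊕ Fin 5) : l1 (d₂val s) ≤ 7 := by
  rcases s with s | t
  · fin_cases s
    · change l1 (0 : R₉) ≤ 7
      rw [l1, wnorm_zero]; norm_num
    · change l1 (0 : R₉) ≤ 7
      rw [l1, wnorm_zero]; norm_num
    · change l1 (X (Sum.inl 3) : R₉) ≤ 7
      rw [l1, wnorm_X, normRingSeminorm_int_one]; norm_num
    · exact l1_quad_le 2
  · change l1 (0 : R₉) ≤ 7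
    rw [l1, wnorm_zero]; norm_num

/-- The substitution `sval` has values of degree `≤ 1`. [folklore] -/
theorem totalDegree_sval_le (s : Fin 4 ⊕ Fin 5) : (sval s).totalDegree ≤ 1 := by
  rcases s with s | t
  · fin_cases s <;> (change (X _ : R₅).totalDegree ≤ 1; rw [totalDegree_X])
  · change (X t : R₅).totalDegree ≤ 1
    rw [totalDegree_X]

/-- The substitution `sval` has values of `l1`-norm `≤ 1`. [folklore] -/
theorem l1_sval_le (s : Fin 4 ⊕ Fin 5) : l1 (sval s) ≤ 1 := by
  rcases s with s | t
  · fin_cases s <;> (change l1 (X _ : R₅) ≤ 1; rw [l1, wnorm_X, normRingSeminorm_int_one])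
  · change l1 (X t : R₅) ≤ 1
    rw [l1, wnorm_X, normRingSeminorm_int_one]

/-- `l1 (X_u^i) ≤ 1` in `R₉`. [folklore] -/
theorem l1_X_pow_le (u : Fin 4 ⊕ Fin 5) (i : ℕ) : l1 (X u ^ i : R₉) ≤ 1 :=
  wnorm_X_pow_le (normRingSeminorm ℤ) (by simp) u i

/-- **Degree bound** `deg U₁(λ₁, a) ≤ λ₁ + a` (each derivative raises the degree by at most `1`;
Masser (9): sizes `≤ (μ + 2λ + 1)^… c₂^{λ+μ}`). [cite: Masser1975, Lemma 1.2] -/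
theorem totalDegree_U₁_le (i a : ℕ) : (U₁ i a).totalDegree ≤ i + a := by
  unfold U₁ D₁₀
  refine (totalDegree_aeval_le_of_le_one _ totalDegree_sval_le _).trans ?_
  refine (totalDegree_mkDerivation_pow_le d₁val totalDegree_d₁val_le a _).trans ?_
  rw [totalDegree_X_pow]

/-- **Degree bound** `deg U₂(λ₂, c) ≤ λ₂ + c`. [cite: Masser1975, Lemma 1.2] -/
theorem totalDegree_U₂_le (k c : ℕ) : (U₂ k c).totalDegree ≤ k + c := by
  unfold U₂ D₂₀
  refine (totalDegree_aeval_le_of_le_one _ totalDegree_sval_le _).trans ?_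
  refine (totalDegree_mkDerivation_pow_le d₂val totalDegree_d₂val_le c _).trans ?_
  rw [totalDegree_X_pow]

/-- **Height bound** `l1 U₁(λ₁, a) ≤ (7(λ₁ + a))^a` (Masser's Lemma 1.2: "`|U| ≤ m! c₃^{ℓ+m}`").
[cite: Masser1975, Lemma 1.2] -/
theorem l1_U₁_le (i a : ℕ) : l1 (U₁ i a) ≤ (7 * ((i : ℝ) + a)) ^ a := by
  unfold U₁ D₁₀
  set Q : R₉ := X (Sum.inl 0) ^ i with hQ
  set P : R₉ := ((MvPolynomial.mkDerivation ℤ d₁val).toLinearMap ^ a) Q with hP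
  have hQdeg : Q.totalDegree = i := totalDegree_X_pow _ _
  have hl1P : l1 P ≤ (7 * ((i : ℝ) + a)) ^ a := by
    refine (l1_mkDerivation_pow_le d₁val (by norm_num) l1_d₁val_le totalDegree_d₁val_le a Q).trans ?_
    rw [hQdeg]
    have hQl1 : l1 Q ≤ 1 := l1_X_pow_le _ _
    have h0 : 0 ≤ (7 * ((i : ℝ) + a)) ^ a := by positivity
    calc (7 * ((i : ℝ) + a)) ^ a * l1 Q ≤ (7 * ((i : ℝ) + a)) ^ a * 1 := by gcongr
      _ = (7 * ((i : ℝ) + a)) ^ a := mul_one _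
  calc l1 (MvPolynomial.aeval sval P) ≤ l1 P * 1 ^ P.totalDegree :=
        l1_aeval_le _ le_rfl l1_sval_le P
    _ ≤ (7 * ((i : ℝ) + a)) ^ a := by rw [one_pow, mul_one]; exact hl1P

/-- **Height bound** `l1 U₂(λ₂, c) ≤ (7(λ₂ + c))^c`. [cite: Masser1975, Lemma 1.2] -/
theorem l1_U₂_le (k c : ℕ) : l1 (U₂ k c) ≤ (7 * ((k : ℝ) + c)) ^ c := by
  unfold U₂ D₂₀
  set Q : R₉ := X (Sum.inl 2) ^ k with hQ
  set P : R₉ := ((MvPolynomial.mkDerivation ℤ d₂val).toLinearMap ^ c) Q with hP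
  have hQdeg : Q.totalDegree = k := totalDegree_X_pow _ _
  have hl1P : l1 P ≤ (7 * ((k : ℝ) + c)) ^ c := by
    refine (l1_mkDerivation_pow_le d₂val (by norm_num) l1_d₂val_le totalDegree_d₂val_le c Q).trans ?_
    rw [hQdeg]
    have hQl1 : l1 Q ≤ 1 := l1_X_pow_le _ _
    have h0 : 0 ≤ (7 * ((k : ℝ) + c)) ^ c := by positivity
    calc (7 * ((k : ℝ) + c)) ^ c * l1 Q ≤ (7 * ((k : ℝ) + c)) ^ c * 1 := by gcongr
      _ = (7 * ((k : ℝ) + c)) ^ c := mul_one _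
  calc l1 (MvPolynomial.aeval sval P) ≤ l1 P * 1 ^ P.totalDegree :=
        l1_aeval_le _ le_rfl l1_sval_le P
    _ ≤ (7 * ((k : ℝ) + c)) ^ c := by rw [one_pow, mul_one]; exact hl1P

end Formal

/-! ### The coefficient norm -/

/-- The `ℓ¹`-norm of the coefficient array (only indices `≤ n` enter). [folklore] -/
def coeffSum (n : ℕ) (p : ℕ → ℕ → ℂ) : ℝ :=
  ∑ i ∈ Finset.range (n + 1), ∑ j ∈ Finset.range (n + 1), ‖p i j‖

/-- `coeffSum ≥ 0`. [folklore] -/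
theorem coeffSum_nonneg (n : ℕ) (p : ℕ → ℕ → ℂ) : 0 ≤ coeffSum n p :=
  Finset.sum_nonneg fun _ _ => Finset.sum_nonneg fun _ _ => norm_nonneg _

/-- Each coefficient is bounded by `coeffSum`. [folklore] -/
theorem norm_le_coeffSum (n : ℕ) (p : ℕ → ℕ → ℂ) {i j : ℕ} (hi : i ≤ n) (hj : j ≤ n) :
    ‖p i j‖ ≤ coeffSum n p := by
  unfold coeffSum
  have h1 : ‖p i j‖ ≤ ∑ j' ∈ Finset.range (n + 1), ‖p i j'‖ :=
    Finset.single_le_sum (f := fun j' => ‖p i j'‖) (fun _ _ => norm_nonneg _)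
      (Finset.mem_range.mpr (Nat.lt_succ_of_le hj))
  exact h1.trans (Finset.single_le_sum (f := fun i' => ∑ j' ∈ Finset.range (n + 1), ‖p i' j'‖)
    (fun _ _ => Finset.sum_nonneg fun _ _ => norm_nonneg _)
    (Finset.mem_range.mpr (Nat.lt_succ_of_le hi)))

end Literature.NumberTheory.Transcendental.Masser1975
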